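import Mathlib
import Summits.PneNP.PneNP.Theses.OneSlice
import Summits.PneNP.PneNP.Theorems.OneSliceSliceTargetSplit
import Summits.PneNP.PneNP.Theorems.OneSliceMonotoneContinuationDefs

/-!
# Route OneSlice, crux `MonotoneContinuation` (stmt-PneNP-18471), line `Sketch_ideator1_r1` — bridge infrastructure B1

The plan of the bridge `MC → flat-above on the low side of the window` (cycle 2 of the lead) and its first, elementary piece B1.

Decomposition (each `sorry` a cycle-2 sub-goal; B4–B6 use the landed wave-2/3 infrastructure):
* B1 `monotoneSeq_close` — a non-decreasing sequence `d_s ∈ [0,1]` whose `b`-weighted `L¹` distance to the constant `α` is `≤ δ`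
  is within `δ'` of `α` at every index `s₀` having weight `≥ δ/δ'` on both sides (`Σ_{s ≥ s₀} b_s ≥ δ/δ'`, `Σ_{s ≤ s₀} b_s ≥ δ/δ'`).
* B2 `shell_two_sided_mass` — for `Bin(N, p)` with `Np → ∞`: the mass of `[m + L√m, ∞)` and of `(−∞, m − L√m]` is eventually
  `≥ c(L) > 0` (modal lower bound `sqrt_mul_binomPMF_mode_ge` + controlled weight ratios within `O(√m)` of the mode).
* B3 `levelDensity_of_l1_close` — `‖𝟙[C'] − ĝ‖_{L¹(μ_p)} ≤ δ`, `C'` monotone, `E_s ĝ = α` (stub_levelAverage) ⇒ `|dens_s(C') − α| ≤ δ'` on the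
  inner shell (B1 + B2 + `ShallowSliceBound.sliceAvg_mono`).
* B4 `padRep_faithful` — `C₁ := Maj_{i≤t} C'(· ∨ ρ_i)` (landed `stub_samplerCircuit`, padding case) is `η`-faithful to `h = C|_j` on slice `j`
  for suitable fixed `ρ_i` (derandomize_general with `ν` = uniform on slice `j`; votes correct by chain_constancy_down from the landing level
  to level `j` + `C' ≈ round ĝ` on the shell + landing-level concentration via stub_samplerExpansion/stub_binomialMixing).
* B5 `padRep_flat_above` — the same `C₁` has `profile C₁ (j+r) − profile C₁ j ≤ η` for `r ≤ L√j` (votes at level `j+r` land at level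
  `≈ m + r` inside the shell; chain constancy + nearBoolean_mono_above give `Pr[C₁ = 1 on slice j+r] = α ± O(η)`).
* B6 assembly `mcImpliesFlatAbove` (statement in `Bridge.lean`).
-/

set_option linter.dupNamespace false

namespace Summit.PneNP.PneNP.Theorems.MonotoneContinuation

open Finset

noncomputable section

/-- **B1.** A non-decreasing real sequence close in weighted `L¹` to a constant is close to it wherever both tails carry weight. -/
theorem monotoneSeq_close (d b : ℕ → ℝ) (α δ δ' : ℝ) (S : Finset ℕ) (hδ' : 0 < δ')
    (hmono : ∀ s t, s ≤ t → d s ≤ d t) (hb : ∀ s, 0 ≤ b s)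
    (hclose : ∑ s ∈ S, b s * |d s - α| ≤ δ) (s₀ : ℕ)
    (hup : δ / δ' < ∑ s ∈ S.filter (fun s => s₀ ≤ s), b s)
    (hdown : δ / δ' < ∑ s ∈ S.filter (fun s => s ≤ s₀), b s) :
    |d s₀ - α| ≤ δ' := by
  by_contra hcon
  push Not at hcon
  have hδ : δ' * (δ / δ') = δ := by field_simp
  rcases lt_or_ge 0 (d s₀ - α) with hpos | hnonpos
  · -- `d s₀ > α + δ'`: every later term is at least `δ'` off
    have habs : δ' < d s₀ - α := by rwa [abs_of_pos hpos] at hcon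
    have key : δ' * ∑ s ∈ S.filter (fun s => s₀ ≤ s), b s ≤ ∑ s ∈ S, b s * |d s - α| := by
      rw [mul_sum]
      calc ∑ s ∈ S.filter (fun s => s₀ ≤ s), δ' * b s
          ≤ ∑ s ∈ S.filter (fun s => s₀ ≤ s), b s * |d s - α| := by
            refine sum_le_sum fun s hs => ?_
            have hs₀ : s₀ ≤ s := (mem_filter.1 hs).2
            have h1 : δ' ≤ |d s - α| := by
              rw [abs_of_pos (by linarith [hmono s₀ s hs₀])]
              linarith [hmono s₀ s hs₀]
            rw [mul_comm]
            exact mul_le_mul_of_nonneg_left h1 (hb s)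
        _ ≤ ∑ s ∈ S, b s * |d s - α| :=
            sum_le_sum_of_subset_of_nonneg (filter_subset _ _) fun s _ _ => mul_nonneg (hb s) (abs_nonneg _)
    have : δ' * (δ / δ') < δ' * ∑ s ∈ S.filter (fun s => s₀ ≤ s), b s := mul_lt_mul_of_pos_left hup hδ'
    linarith
  · -- `d s₀ < α - δ'`: every earlier term is at least `δ'` off
    have habs : δ' < α - d s₀ := by rw [abs_of_nonpos hnonpos] at hcon; linarith
    have key : δ' * ∑ s ∈ S.filter (fun s => s ≤ s₀), b s ≤ ∑ s ∈ S, b s * |d s - α| := by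
      rw [mul_sum]
      calc ∑ s ∈ S.filter (fun s => s ≤ s₀), δ' * b s
          ≤ ∑ s ∈ S.filter (fun s => s ≤ s₀), b s * |d s - α| := by
            refine sum_le_sum fun s hs => ?_
            have hs₀ : s ≤ s₀ := (mem_filter.1 hs).2
            have h1 : δ' ≤ |d s - α| := by
              rw [abs_of_nonpos (by linarith [hmono s s₀ hs₀])]
              linarith [hmono s s₀ hs₀]
            rw [mul_comm]
            exact mul_le_mul_of_nonneg_left h1 (hb s)
        _ ≤ ∑ s ∈ S, b s * |d s - α| :=
            sum_le_sum_of_subset_of_nonneg (filter_subset _ _) fun s _ _ => mul_nonneg (hb s) (abs_nonneg _)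
    have : δ' * (δ / δ') < δ' * ∑ s ∈ S.filter (fun s => s ≤ s₀), b s := mul_lt_mul_of_pos_left hdown hδ'
    linarith

/-- **B1, registered form** (`monotoneSeqClose`, sub-goal of stmt-PneNP-18471): a non-decreasing real sequence that is `δ`-close in
`b`-weighted `L¹` (over a finite index set) to a constant `α` is within `δ'` of `α` at every index whose two tails each carry weight
`> δ/δ'`. [folklore] -/
theorem monotoneSeqClose :
  ∀ (d b : ℕ → ℝ) (α δ δ' : ℝ) (S : Finset ℕ), 0 < δ' → (∀ s t, s ≤ t → d s ≤ d t) → (∀ s, 0 ≤ b s) →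
    ∑ s ∈ S, b s * |d s - α| ≤ δ → ∀ s₀ : ℕ,
    δ / δ' < ∑ s ∈ S.filter (fun s => s₀ ≤ s), b s → δ / δ' < ∑ s ∈ S.filter (fun s => s ≤ s₀), b s →
    |d s₀ - α| ≤ δ' :=
  fun d b α δ δ' S hδ' hmono hb hclose s₀ hup hdown => monotoneSeq_close d b α δ δ' S hδ' hmono hb hclose s₀ hup hdown

end

end Summit.PneNP.PneNP.Theorems.MonotoneContinuation
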